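import Mathlib
import HarnessLib
import Summits.QuantumFields.YangMills.Theses.GuardedThresholdRemoval

/-!
# GuardedThresholdRemoval — the `K = 0` rung of `UnitLawCollarDominated` / `GuardSphereThin` (BC5 witness, LINE g7-B of ym-idea-1)

Route `route-QuantumFields-GuardedThresholdRemoval` (closes rung R3 `T3YM3TorusStatement.YM3Torus(Matrix.specialUnitaryGroup (Fin 2) ℂ)`; no summit is proved by this line)
splits its key lemma `GuardSphereThin` (stmt-QuantumFields-28025) into `UnitLawCollarDominated` (28045: K-UNIFORM local domination of
the unit laws `ν_K^{(1)}` by product Haar measure near the guard spheres of the printed averaging) and `GuardCollarHaarSmall` (28046).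
This file lands the FIRST RUNG of 28045: at cut-off `K = 0` (no averaging step yet) the unit law of every family `F`, at every
coupling `γ ≥ 0`, is the Wilson–Haar Gibbs law of the unit torus relabelled by the level shift, hence dominated by `Z₀⁻¹ ·` product Haar
measure on ALL sets (`e^{−βA} ≤ 1`, `Z₀ > 0`, the level shift preserves Haar measure): `unitLaw_zero_le`,
`unitLawCollarDominated_rung_zero`.  The open content of the crux is exactly the UNIFORMITY of such a constant in `K ≥ K₀` on a guard
collar — the law form of the density version of ultraviolet stability [Balaban1985UV3, Thm 1 p.257 with (1)–(3) p.256]; the rung lies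
outside the leaf's known regime trivially (the leaf is known for no family) and exercises the route's lever (domination ⇒ thinness via
Haar geometry, `guardSphereThin_of_collar`).
-/

open MeasureTheory
open Literature.MathematicalPhysics.QuantumFieldTheory.Balaban1983to89
open Literature.MathematicalPhysics.QuantumFieldTheory.Balaban1983to89.Missing
open Literature.MathematicalPhysics.QuantumFieldTheory.Balaban1983to89.T3ContinuumYM3Torus
open Literature.MathematicalPhysics.QuantumFieldTheory.Balaban1983to89.T3LevelShift
open Literature.MathematicalPhysics.QuantumFieldTheory.Balaban1983to89.T3UnitLawDensityEML (ℰp measurableE_ℰp)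

namespace Summit.QuantumFields.YangMills.Theses.GuardedThresholdRemoval

/-- The level-`0` averaging-and-shift map of the unit factorisation is the bare level shift (`iter 0 = id`). [folklore] -/
theorem unitFactorisation_A_zero (F : T3Family) (ℰ : LoopAverage (Matrix.specialUnitaryGroup (Fin 2) ℂ)) (hE : ℰ.MeasurableE) (γ : ℝ) :
    (F.unitFactorisation ℰ hE γ).A 0 = unitShift F 0 := by
  funext U; rfl

/-- At cut-off `K = 0` (no averaging step) the unit law is the Wilson–Haar Gibbs law of the unit torus relabelled, hence dominated by
`Z₀⁻¹ ·` product Haar measure: `e^{−βA} ≤ 1`. -/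
theorem unitLaw_zero_le (F : T3Family) (ℰ : LoopAverage (Matrix.specialUnitaryGroup (Fin 2) ℂ)) (hE : ℰ.MeasurableE) {γ : ℝ} (hγ : 0 ≤ γ) :
    F.unitLaw ℰ hE γ 0 ≤
      (ENNReal.ofReal (partitionFn (G := (Matrix.specialUnitaryGroup (Fin 2) ℂ)) (F.P 0) ((F.scheme ℰ γ).β 0)))⁻¹ • fieldMeasure (F.P 0) 0 (Matrix.specialUnitaryGroup (Fin 2) ℂ) := by
  have hβ : 0 ≤ (F.scheme ℰ γ).β 0 := F.scheme_β_nonneg ℰ hγ 0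
  rw [T3Family.unitLaw, T4VarianceMatching.UnitFactorisation.effLaw, unitFactorisation_A_zero]
  have hgibbs : T4GenFunBounds.gibbsMeasure (G := (Matrix.specialUnitaryGroup (Fin 2) ℂ)) (F.P 0) ((F.scheme ℰ γ).β 0) ≤
      (ENNReal.ofReal (partitionFn (G := (Matrix.specialUnitaryGroup (Fin 2) ℂ)) (F.P 0) ((F.scheme ℰ γ).β 0)))⁻¹ • fieldMeasure (F.P 0) 0 (Matrix.specialUnitaryGroup (Fin 2) ℂ) := by
    rw [T4GenFunBounds.gibbsMeasure]
    have hwd : (fieldMeasure (F.P 0) 0 (Matrix.specialUnitaryGroup (Fin 2) ℂ)).withDensity (fun U => ENNReal.ofReal (boltzmann (F.P 0) ((F.scheme ℰ γ).β 0) U))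
        ≤ fieldMeasure (F.P 0) 0 (Matrix.specialUnitaryGroup (Fin 2) ℂ) := by
      calc (fieldMeasure (F.P 0) 0 (Matrix.specialUnitaryGroup (Fin 2) ℂ)).withDensity (fun U => ENNReal.ofReal (boltzmann (F.P 0) ((F.scheme ℰ γ).β 0) U))
          ≤ (fieldMeasure (F.P 0) 0 (Matrix.specialUnitaryGroup (Fin 2) ℂ)).withDensity 1 :=
            withDensity_mono (ae_of_all _ fun U => by
              simpa using ENNReal.ofReal_le_one.mpr (boltzmann_le_one (F.P 0) hβ U))
        _ = fieldMeasure (F.P 0) 0 (Matrix.specialUnitaryGroup (Fin 2) ℂ) := withDensity_one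
    refine Measure.le_iff'.2 fun s => ?_
    simp only [Measure.smul_apply, smul_eq_mul]
    exact mul_le_mul_of_nonneg_left (Measure.le_iff'.1 hwd s) bot_le
  calc Measure.map (unitShift F 0) (T4GenFunBounds.gibbsMeasure (G := (Matrix.specialUnitaryGroup (Fin 2) ℂ)) (F.P 0) ((F.scheme ℰ γ).β 0))
      ≤ Measure.map (unitShift F 0)
          ((ENNReal.ofReal (partitionFn (G := (Matrix.specialUnitaryGroup (Fin 2) ℂ)) (F.P 0) ((F.scheme ℰ γ).β 0)))⁻¹ • fieldMeasure (F.P 0) 0 (Matrix.specialUnitaryGroup (Fin 2) ℂ)) :=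
        Measure.map_mono hgibbs (measurable_unitShift F 0)
    _ = (ENNReal.ofReal (partitionFn (G := (Matrix.specialUnitaryGroup (Fin 2) ℂ)) (F.P 0) ((F.scheme ℰ γ).β 0)))⁻¹ • fieldMeasure (F.P 0) 0 (Matrix.specialUnitaryGroup (Fin 2) ℂ) := by
        rw [Measure.map_smul, (measurePreserving_unitShift F 0).map_eq]

/-- **BC5 rung (K = 0) of the crux `UnitLawCollarDominated` (stmt-QuantumFields-28045) and of its parent `GuardSphereThin` (28025):**
at cut-off `K = 0` the unit law of EVERY family at EVERY coupling `γ ≥ 0` is dominated by product Haar measure on ALL sets (not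
only on a guard collar), with constant `Z₀⁻¹`. The open content of the crux is the uniformity of such a constant in `K ≥ K₀`. -/
theorem unitLawCollarDominated_rung_zero (F : T3Family) {γ : ℝ} (hγ : 0 ≤ γ) :
    ∃ C : ℝ, ∀ S : Set (GaugeField (F.P 0) 0 (Matrix.specialUnitaryGroup (Fin 2) ℂ)),
      (F.unitLaw ℰp measurableE_ℰp γ 0).real S ≤ C * (fieldMeasure (F.P 0) 0 (Matrix.specialUnitaryGroup (Fin 2) ℂ)).real S := by
  set Z : ℝ := partitionFn (G := (Matrix.specialUnitaryGroup (Fin 2) ℂ)) (F.P 0) ((F.scheme ℰp γ).β 0) with hZ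
  have hZpos : 0 < Z := partitionFn_pos' (F.P 0) (F.scheme_β_nonneg ℰp hγ 0)
  refine ⟨Z⁻¹, fun S => ?_⟩
  have hle := Measure.le_iff'.1 (unitLaw_zero_le F ℰp measurableE_ℰp hγ) S
  have hc : (ENNReal.ofReal Z)⁻¹ ≠ ⊤ := ENNReal.inv_ne_top.mpr (by simpa using hZpos)
  have hfin : ((ENNReal.ofReal Z)⁻¹ • fieldMeasure (F.P 0) 0 (Matrix.specialUnitaryGroup (Fin 2) ℂ)) S ≠ ⊤ := by
    rw [Measure.smul_apply, smul_eq_mul]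
    exact ENNReal.mul_ne_top hc (measure_ne_top _ _)
  calc (F.unitLaw ℰp measurableE_ℰp γ 0).real S
      = ((F.unitLaw ℰp measurableE_ℰp γ 0) S).toReal := rfl
    _ ≤ (((ENNReal.ofReal Z)⁻¹ • fieldMeasure (F.P 0) 0 (Matrix.specialUnitaryGroup (Fin 2) ℂ)) S).toReal := ENNReal.toReal_mono hfin hle
    _ = Z⁻¹ * (fieldMeasure (F.P 0) 0 (Matrix.specialUnitaryGroup (Fin 2) ℂ)).real S := by
        rw [Measure.smul_apply, smul_eq_mul, ENNReal.toReal_mul, ENNReal.toReal_inv, ENNReal.toReal_ofReal hZpos.le]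
        rfl

end Summit.QuantumFields.YangMills.Theses.GuardedThresholdRemoval
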